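import Mathlib
import Summits.ValiantsHypothesis.ValiantsHypothesis.Theorems.GrenetZeonTwoDimCoefficientsScalingHessianMassCut
import Summits.ValiantsHypothesis.ValiantsHypothesis.Theorems.GrenetZeonTwoDimCoefficientsScalingSupportGarbage
import Summits.ValiantsHypothesis.ValiantsHypothesis.Theorems.GrenetZeonTwoDimCoefficientsScalingBlockDiagTrace

/-!
# Crux `GrenetZeon.TwoDimCoefficients` (stmt-ValiantsHypothesis-8062) / rung `DualUnipotentThreeHalves` (stmt-24318):
# scaling-closure — ★★★ the 3/2 rung for BLOCK-DIAGONAL pencils with index-`n` blocks and support-garbage blocks (unconditional)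

Assembly of the mass cut in Hessian currency (✓ p838341), the support-garbage pricing (✓ p838439) and the block-diagonal
bookkeeping (✓ `trace_pow_mul_eq_sum_classPencil`): in the normal form `per_n = tr(N^{n−1}·M)` (✓ `exists_nilpotent_pencil_of_dualUnipotentRepr`)
suppose `N` is BLOCK-DIAGONAL for a labelling `lvl`, and every class `p` is either GOOD — its class pencil has nil-index `≤ n` — or
GARBAGE — its class pencil only involves the variables of a fixed set `S`.  Then

  `(n² − 2|S|)·n ≤ 2·Σ_{p good} s_p²`   (`s_p` = size of class `p`),

so `|S| ≤ n²/4 ⟹ n³ ≤ 4·Σ_good s_p² ≤ 4m²`.  König garbage (`S` = one row, which KILLS the substitution route — memo §9), scalar garbage,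
and any bounded-support garbage are thereby harmless, with NO hypothesis on the permanent side and NO index-cost hypothesis.

* ★★★ `sq_sub_mul_le_of_blockDiagonal_goodOrGarbage` — the statement above.

HONEST FRAMING: unconditional for the stated class (block-DIAGONAL after the normal form; block-triangular coupling, triangularisable
blocks of large index on many variables, and wild blocks of index `> n` are NOT covered — memo §10 (P2)–(P4)); the stub `DualUnipotentBound`,
crux 8062, the 24318 decl and `VP ≠ VNP` remain open.

References: T. Mignon, N. Ressayre, Int. Math. Res. Not. 2004:79, Thm. 1.1 (via the tree); folklore.
-/

-- single-conjunct layout `Summits/ValiantsHypothesis/ValiantsHypothesis`: the duplicated namespace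
-- component is mandated by the tree.
set_option linter.dupNamespace false
set_option autoImplicit false

noncomputable section

namespace Summit.ValiantsHypothesis.ValiantsHypothesis.Theorems.GrenetZeonTwoDimCoefficients.ScalingClosure

open MvPolynomial Matrix
open Literature.Computability.AlgebraicComplexity
open Summit.ValiantsHypothesis.ValiantsHypothesis.Cruxes.TwoDimCoefficients.DimTwoCases
open Summit.ValiantsHypothesis.ValiantsHypothesis.Theorems.GrenetZeon.SlowCore

section BlockDiagonalRung

variable {n m : ℕ}

/-- ★★★ **The 3/2 rung for block-diagonal pencils with index-`n` blocks and support garbage.**  Normal form `per_n = tr(N^{n−1}M)`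
with `N, M` linear, `N` block-diagonal for `lvl`; classes in `good` have class pencils of nil-index `≤ n`, the other classes have class
pencils involving only the variables of `S`.  Then `(n² − 2|S|)·n ≤ 2·Σ_{p ∈ good levels} s_p²` (`n ≥ 2`).
[cite: MignonRessayre2004, Thm. 1.1 — via the tree; folklore] -/
theorem sq_sub_mul_le_of_blockDiagonal_goodOrGarbage (hn : 2 ≤ n) (N M : AffMat n m)
    (hN : ∀ i j, (N i j).IsHomogeneous 1) (hM : ∀ i j, (M i j).IsHomogeneous 1)
    (hper : perPoly (Fin n) ℂ = (N ^ (n - 1) * M).trace)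
    (lvl : Fin m → ℕ) (hdiag : ∀ a b, lvl a ≠ lvl b → N a b = 0)
    (s : ℕ → ℕ) (e : ∀ p : ℕ, {i : Fin m // lvl i = p} ≃ Fin (s p))
    (good : Finset ℕ) (hgoodsub : good ⊆ Finset.univ.image lvl)
    (hgood : ∀ p ∈ good, (classPencil N (e p)) ^ n = 0)
    (S : Finset (Fin n × Fin n))
    (hbad : ∀ p ∈ Finset.univ.image lvl, p ∉ good → ∀ a b, ∀ c ∉ S, pderiv c (classPencil N (e p) a b) = 0) :
    (n ^ 2 - 2 * S.card) * n ≤ 2 * ∑ p ∈ good, s p ^ 2 := by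
  classical
  -- the decomposition into constituents
  have hsplit := trace_pow_mul_eq_sum_classPencil lvl N M hdiag s e (n - 1)
  set levels := Finset.univ.image lvl with hlev
  set g : MvPolynomial (Fin n × Fin n) ℂ :=
    ∑ p ∈ levels.filter (fun p => p ∉ good), ((classPencil N (e p)) ^ (n - 1) * classPencil M (e p)).trace with hg
  have hgood_eq : levels.filter (fun p => p ∈ good) = good := by
    ext p
    rw [Finset.mem_filter]
    exact ⟨fun h => h.2, fun h => ⟨hgoodsub h, h⟩⟩
  have hper' : perPoly (Fin n) ℂ =
      (∑ p ∈ good, ((classPencil N (e p)) ^ (n - 1) * classPencil M (e p)).trace) + g := by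
    rw [hper, hsplit, ← hgood_eq, hg]
    exact (Finset.sum_filter_add_sum_filter_not levels (fun p => p ∈ good) _).symm
  -- the garbage part is linear off `S`
  have hgS : ∀ c c', c ∉ S → c' ∉ S → pderiv c (pderiv c' g) = 0 := by
    intro c c' hc hc'
    rw [hg, map_sum, map_sum]
    refine Finset.sum_eq_zero fun p hp => ?_
    rw [Finset.mem_filter] at hp
    exact pderiv_pderiv_trace_pow_mul_eq_zero _ _ S (hbad p hp.1 hp.2)
      (isAffine_classPencil M (fun i j => (hM i j).totalDegree_le) (e p)) (n - 1) c c' hc hc'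
  -- re-index the good classes by `Fin r`
  set r := good.card with hr
  set enum : Fin r → ℕ := fun i => (good.equivFin.symm i : ℕ) with henum
  have henum_mem : ∀ i, enum i ∈ good := fun i => (good.equivFin.symm i).2
  have hsum_enum : ∀ f : ℕ → MvPolynomial (Fin n × Fin n) ℂ, ∑ p ∈ good, f p = ∑ i : Fin r, f (enum i) := by
    intro f
    rw [← Finset.sum_coe_sort good]
    exact (Fintype.sum_equiv good.equivFin.symm (fun i => f (enum i)) (fun x => f x) (fun i => rfl)).symm
  have hsum_enum_nat : ∑ p ∈ good, s p ^ 2 = ∑ i : Fin r, s (enum i) ^ 2 := by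
    rw [← Finset.sum_coe_sort good]
    exact (Fintype.sum_equiv good.equivFin.symm (fun i => s (enum i) ^ 2) (fun x => s x ^ 2) (fun i => rfl)).symm
  rw [hsum_enum_nat]
  refine sq_sub_mul_le_of_tracePowParts_add_supportPart hn (fun i => s (enum i))
    (fun i => classPencil N (e (enum i))) (fun i => classPencil M (e (enum i))) (fun _ => 1)
    (fun i a b => hN _ _) (fun i a b => hM _ _) (fun i => hgood _ (henum_mem i))
    (fun i => pow_card_eq_zero_of_pow_eq_zero _ (hgood _ (henum_mem i))) g S hgS ?_
  rw [hper', hsum_enum]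
  simp only [map_one, one_mul]

end BlockDiagonalRung

end Summit.ValiantsHypothesis.ValiantsHypothesis.Theorems.GrenetZeonTwoDimCoefficients.ScalingClosure

end
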